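import Summits.ResolutionOfSingularities.ResolutionOfSingularities.Theorems.FrobeniusLadderFRationalResolutionFixedStratumGenericPoint
import HarnessLib

/-!
# Crux `FrobeniusLadder.FRationalResolution` (stmt-ResolutionOfSingularities-15317), line `redirect`,
# stub `stub_diagonalizableQuotientResolution` — **re-basing the invariant at ANY point of the stratum near `𝔭`
# (not only at primes below `𝔭`): unit face and Kato ideal are constant** (design C3 = the rank-2 stratum layer of
# the non-isolated case, memo MEMO-15317-leafhand2-g10 §2 (L3-b): the global round `X ↦ Bl_{𝓘_{Sing X}} X` meets new
# singular points over every CLOSED point `x′` of the stratum through `x`, whose prime `𝔮` is INCOMPARABLE with `𝔭`;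
# `…FixedStratumChains.faceMonoid_eq_of_le_of_ideal_le` / `…FixedStratumGenericPoint.ideal_eq_of_le_of_ideal_le`
# assumed `𝔮 ⊆ 𝔭` — here the hypothesis is the correct local one: `I(𝔭) ⊆ 𝔮` and `φ(F_𝔭)` consists of units at `𝔮`)

* `faceMonoid_eq_of_ideal_le_of_forall_not_mem`, `ideal_eq_of_ideal_le_of_forall_not_mem` — for any prime `𝔮` with
  `I(𝔭, φ) ⊆ 𝔮` and `φ(f) ∉ 𝔮` for `f ∈ F_𝔭`: `F_𝔮 = F_𝔭` and `I(𝔮, φ) = I(𝔭, φ)`; so every hypothesis of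
  `…FixedStratumNextRound.exists_fixedPrime_package_of_stratum` / `…FixedStratumBlowupPoints.stalk_regular_or_fixedPrime_of_stratum`
  phrased through `ℤF_𝔭` is literally the same at `𝔮` (one `rw`);
* `forall_not_mem_of_closure` — the unit condition from finitely many generators of the face (it holds on the basic
  open where their images are invertible);
* **`face_zero_package`** — the case of the C3 recursion (sharp rank-2 base chart, unit face `0` at `𝔭`): for EVERY
  prime `𝔮 ⊇ I(𝔭, φ)` one has unit face `0` at `𝔮`, `F_𝔮 = F_𝔭`, `I(𝔮) = I(𝔭)` — no unit condition needed.

Honest label: bookkeeping toward ONE leaf stub (no stub, crux or summit closed). No definitions, no named facts, no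
sorry. [cite: Kato1994, Def. (2.1), (7.3)]
-/

noncomputable section

-- single-problem summit: the doubled namespace component is forced
set_option linter.dupNamespace false

open IsLocalRing Literature.AlgebraicGeometry.Resolution Literature.AlgebraicGeometry.Resolution.LogChart

namespace Summit.ResolutionOfSingularities.ResolutionOfSingularities.Theorems.FRationalResolution.FixedStratumNearby

universe u

variable {A : Type u} [CommRing A] {n : ℕ} {P : AddSubmonoid (Fin n → ℤ)} {φ : Multiplicative P →* A}
  {𝔭 𝔮 : Ideal A} [𝔭.IsPrime] [𝔮.IsPrime]

/-- **The unit face is constant on the stratum near `𝔭`**: `I(𝔭) ⊆ 𝔮` and `φ(F_𝔭) ∩ 𝔮 = ∅` give `F_𝔮 = F_𝔭`.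
[cite: Kato1994, Def. (2.1), (7.3)] -/
theorem faceMonoid_eq_of_ideal_le_of_forall_not_mem (hI : ideal P φ 𝔭 ≤ 𝔮)
    (hF : ∀ v ∈ faceMonoid P φ 𝔭, val P φ v ∉ 𝔮) : faceMonoid P φ 𝔮 = faceMonoid P φ 𝔭 := by
  ext v
  simp only [mem_faceMonoid]
  constructor
  · rintro ⟨hv, h⟩
    refine ⟨hv, fun hv𝔭 => h (hI ?_)⟩
    rw [val_of_mem P φ hv] at hv𝔭 ⊢
    exact Ideal.subset_span ⟨⟨v, hv⟩, hv𝔭, rfl⟩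
  · rintro ⟨hv, h⟩
    exact ⟨hv, hF v ((mem_faceMonoid P φ 𝔭).2 ⟨hv, h⟩)⟩

omit [𝔭.IsPrime] [𝔮.IsPrime] in
/-- **Kato's ideal is constant on the stratum near `𝔭`**: `I(𝔭) ⊆ 𝔮` and `φ(p) ∉ 𝔮` whenever `φ(p) ∉ 𝔭` give
`I(𝔮, φ) = I(𝔭, φ)`. [cite: Kato1994, Def. (2.1), (7.3)] -/
theorem ideal_eq_of_ideal_le_of_forall_not_mem (hI : ideal P φ 𝔭 ≤ 𝔮)
    (hF : ∀ p : P, φ (Multiplicative.ofAdd p) ∉ 𝔭 → φ (Multiplicative.ofAdd p) ∉ 𝔮) :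
    ideal P φ 𝔮 = ideal P φ 𝔭 := by
  have hset : {p : P | φ (Multiplicative.ofAdd p) ∈ 𝔮} = {p : P | φ (Multiplicative.ofAdd p) ∈ 𝔭} := by
    ext p
    simp only [Set.mem_setOf_eq]
    constructor
    · intro h
      by_contra h'
      exact hF p h' h
    · intro h
      exact hI (Ideal.subset_span ⟨p, h, rfl⟩)
  rw [ideal, ideal, hset]

omit [𝔭.IsPrime] in
/-- The unit condition from generators: if the face monoid is the closure of a set `T` whose chart values avoid `𝔮`,
then every face element has chart value outside `𝔮`. [folklore] -/
theorem forall_not_mem_of_closure {F : AddSubmonoid (Fin n → ℤ)} (hFP : F ≤ P) {T : Set (Fin n → ℤ)}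
    (hFT : F = AddSubmonoid.closure T) (hT : ∀ t ∈ T, val P φ t ∉ 𝔮) :
    ∀ v ∈ F, val P φ v ∉ 𝔮 := by
  intro v hv
  rw [hFT] at hv
  have hTP : ∀ t ∈ T, t ∈ P := fun t ht => hFP (hFT ▸ AddSubmonoid.subset_closure ht)
  induction hv using AddSubmonoid.closure_induction with
  | mem t ht => exact hT t ht
  | zero => rw [val_zero]; exact fun h => (Ideal.IsPrime.ne_top inferInstance) (Ideal.eq_top_of_isUnit_mem _ h isUnit_one)
  | add a b ha hb iha ihb =>
    have haP : a ∈ P := hFP (hFT ▸ ha)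
    have hbP : b ∈ P := hFP (hFT ▸ hb)
    rw [val_add P φ haP hbP]
    exact fun h => (Ideal.IsPrime.mem_or_mem inferInstance h).elim iha ihb

/-- **Unit face `0` re-bases for free.** If `φ(P ∖ 0) ⊆ 𝔭` (unit face `0` at `𝔭`) and `I(𝔭, φ) ⊆ 𝔮`, then `φ(P ∖ 0) ⊆ 𝔮`,
`F_𝔮 = F_𝔭` and `I(𝔮, φ) = I(𝔭, φ)` — at EVERY point `𝔮` of the stratum, comparable with `𝔭` or not.
[cite: Kato1994, Def. (2.1), (7.3)] -/
theorem face_zero_package (hface : ∀ p : P, (p : Fin n → ℤ) ≠ 0 → φ (Multiplicative.ofAdd p) ∈ 𝔭)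
    (hI : ideal P φ 𝔭 ≤ 𝔮) :
    (∀ p : P, (p : Fin n → ℤ) ≠ 0 → φ (Multiplicative.ofAdd p) ∈ 𝔮) ∧
      faceMonoid P φ 𝔮 = faceMonoid P φ 𝔭 ∧ ideal P φ 𝔮 = ideal P φ 𝔭 := by
  have hface' : ∀ p : P, (p : Fin n → ℤ) ≠ 0 → φ (Multiplicative.ofAdd p) ∈ 𝔮 :=
    fun p hp => hI (Ideal.subset_span ⟨p, hface p hp, rfl⟩)
  -- at a unit-face-`0` point the only chart unit is `φ(0) = 1`
  have hunit : ∀ (𝔯 : Ideal A) [𝔯.IsPrime], (∀ p : P, (p : Fin n → ℤ) ≠ 0 → φ (Multiplicative.ofAdd p) ∈ 𝔯) →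
      ∀ p : P, φ (Multiplicative.ofAdd p) ∉ 𝔯 → (p : Fin n → ℤ) = 0 := by
    intro 𝔯 _ h p hp
    by_contra hne
    exact hp (h p hne)
  refine ⟨hface', ?_, ?_⟩
  · refine faceMonoid_eq_of_ideal_le_of_forall_not_mem hI fun v hv => ?_
    obtain ⟨hvP, hv𝔭⟩ := (mem_faceMonoid P φ 𝔭).1 hv
    have hv0 : v = 0 := by
      have := hunit 𝔭 hface ⟨v, hvP⟩ (by rw [← val_of_mem P φ hvP]; exact hv𝔭)
      exact this
    subst hv0
    rw [val_zero]
    exact fun h => (Ideal.IsPrime.ne_top inferInstance) (Ideal.eq_top_of_isUnit_mem _ h isUnit_one)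
  · refine ideal_eq_of_ideal_le_of_forall_not_mem hI fun p hp => ?_
    have hp0 : (p : Fin n → ℤ) = 0 := hunit 𝔭 hface p hp
    have : φ (Multiplicative.ofAdd p) = 1 := by
      have hp' : p = 0 := Subtype.ext hp0
      rw [hp', ofAdd_zero, map_one]
    rw [this]
    exact fun h => (Ideal.IsPrime.ne_top inferInstance) (Ideal.eq_top_of_isUnit_mem _ h isUnit_one)

end Summit.ResolutionOfSingularities.ResolutionOfSingularities.Theorems.FRationalResolution.FixedStratumNearby

end
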